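import Summits.BirchSwinnertonDyer.BirchSwinnertonDyer.Theorems.BiquadraticEisensteinDescentHeegnerTwistCouplingInSupplyQuarticCornerAllP
import Mathlib.NumberTheory.LSeries.PrimesInAP
import HarnessLib

set_option linter.dupNamespace false -- `Summit.BirchSwinnertonDyer.BirchSwinnertonDyer.Theorems.…` (summit = sub, D-0017)
set_option autoImplicit false

/-!
# Crux `HeegnerTwistCouplingInSupply` (stmt-BirchSwinnertonDyer-21381) — the corner families are INFINITE: Dirichlet (Mathlib) for the
# `2`-isogeny corners `E_p` (`p ≡ 7 (mod 8)`) and `X_p, X_{p³}` (`p ≡ 15 (mod 16)`), modulo Burungale–Tian ONLY; the progression of the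
# `ℚ(√−2)`-Sylvester family

Route `BiquadraticEisensteinDescent` (cell `pub/bsd-wall`; width seat `bsd-wall-cm-bed-w4` g31; THEOREMS ONLY, `--supports`
stmt-BirchSwinnertonDyer-21381, helper). The corner theorems of the route hold for EVERY prime of an arithmetic progression:
`…RoundingPinCellData.cruxOnEpCornerAllP` (`W = E_p : y² = x³ − p²x`, `p ≡ 7 (mod 8)`; bed-w2 g13) and `…QuarticCornerAllP.cruxOnQuarticCornerAllP`
(`W = X_{p^k} : y² = x³ + p^k x`, `k ∈ {1, 3}`, `p ≡ 15 (mod 16)`; bed-w4 g14), both modulo Burungale–Tian's rank-zero `2`-converse ONLY (the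
`2`-isogeny descents are in the tree). With DIRICHLET's theorem on primes in arithmetic progressions — in Mathlib
(`Nat.infinite_setOf_prime_and_eq_mod`) — these corners are INFINITE families of pairs `(W, p)` of the crux's habitat (CM, `p` inert and bad,
`p → ∞`) at which the conclusion of `HeegnerTwistCouplingInSupply` holds, modulo ONE print fact:

* §1 `infinite_setOf_prime_mod` — `{p prime : p % q = a}` is infinite for a unit residue `a (mod q)` (Dirichlet, `ZMod` bookkeeping);
  the three progressions `7 (mod 8)`, `15 (mod 16)`, `17, 35 (mod 72)`.
* §2 ★★ `infinite_EpCorner` and ★★ `infinite_quarticCorner` (`k = 1` and `k = 3`): infinitely many primes `p` with the conclusion of crux 21381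
  at `(E_p, p)`, resp. `(X_{p^k}, p)` — modulo Burungale–Tian ONLY (no Chebotarev, no descent hypothesis).
* §3 the contrast with `j = 0`: the `ℚ(√−2)`-Sylvester family of `…SylvesterCornerSqrtMinusTwo` lives on the infinite progression
  `p ≡ 17, 35 (mod 72)` (`infinite_setOf_prime_sqrtMinusTwo_progression`, Dirichlet), but its certified subset (`X³ − 3X − 10` irreducible
  mod `p`, density `2/3` in the progression) is a CHEBOTAREV set of a non-abelian sextic field — Dirichlet does not reach it; this is exactly
  the hypothesis `hInf` of `SylvesterCorner.infinite_corner_of_infinite_noRoot` (and `DigitSetInfinite` of w4 g30's digit family).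

HONEST FRAMING: «infinitely many `(W, p)`» is infinitely far from «all CM `W`» (the crux); the residual C⁺ (`stub_nonNullIndivisibleHeegner`),
the registered stubs, crux 21381 and BSD are untouched. No definition, no named fact, no `sorry`; axioms standard.
[cite: BurungaleTian2026, Thm. 1.1] [cite: IrelandRosen1990, Ch. 16 §1 (Dirichlet's theorem)] [cite: SilvermanAEC2009, Prop. X.4.9]
-/

noncomputable section

open scoped Classical NumberField

namespace Summit.BirchSwinnertonDyer.BirchSwinnertonDyer.Theorems.CornersInfinite

open _root_.WeierstrassCurve Literature.NumberTheory.EllipticCurves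
open Summit.BirchSwinnertonDyer.BirchSwinnertonDyer.Theorems.BiquadraticEisensteinDescentHeegnerTwistCouplingInSupplyRoundingPinCellData
  (cruxOnEpCornerAllP)
open Summit.BirchSwinnertonDyer.BirchSwinnertonDyer.Theorems.BiquadraticEisensteinDescentHeegnerTwistCouplingInSupplyQuarticCornerAllP
  (isElliptic_Xpow cruxOnQuarticCornerAllP)

/-! ## §1 Dirichlet, `ZMod` bookkeeping, the three progressions -/

section Dirichlet

/-- **Dirichlet's theorem in residue form**: for `0 < a < q` with `a` a unit mod `q`, infinitely many primes `p` have `p % q = a`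
(Mathlib's `Nat.infinite_setOf_prime_and_eq_mod`, `(p : ZMod q) = a ↔ p % q = a`). [cite: IrelandRosen1990, Ch. 16 §1] -/
theorem infinite_setOf_prime_mod {q a : ℕ} [NeZero q] (haq : a < q) (hu : IsUnit (a : ZMod q)) :
    Set.Infinite {p : ℕ | p.Prime ∧ p % q = a} := by
  refine (Nat.infinite_setOf_prime_and_eq_mod hu).mono fun p hp ↦ ⟨hp.1, ?_⟩
  have h := congrArg ZMod.val hp.2
  rwa [ZMod.val_natCast, ZMod.val_natCast, Nat.mod_eq_of_lt haq] at h

/-- Infinitely many primes `p ≡ 7 (mod 8)`. [cite: IrelandRosen1990, Ch. 16 §1] -/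
theorem infinite_setOf_prime_mod_eight : Set.Infinite {p : ℕ | p.Prime ∧ p % 8 = 7} :=
  infinite_setOf_prime_mod (by norm_num) (isUnit_iff_exists_inv.mpr ⟨(7 : ZMod 8), by decide⟩)

/-- Infinitely many primes `p ≡ 15 (mod 16)`. [cite: IrelandRosen1990, Ch. 16 §1] -/
theorem infinite_setOf_prime_mod_sixteen : Set.Infinite {p : ℕ | p.Prime ∧ p % 16 = 15} :=
  infinite_setOf_prime_mod (by norm_num) (isUnit_iff_exists_inv.mpr ⟨(15 : ZMod 16), by decide⟩)

/-- Infinitely many primes `p ≡ 17 (mod 72)` — the progression of the `ℚ(√−2)`-Sylvester family is infinite (its certified part is a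
Chebotarev set, not reached here). [cite: IrelandRosen1990, Ch. 16 §1] -/
theorem infinite_setOf_prime_sqrtMinusTwo_progression : Set.Infinite {p : ℕ | p.Prime ∧ (p % 72 = 17 ∨ p % 72 = 35)} :=
  (infinite_setOf_prime_mod (q := 72) (a := 17) (by norm_num) (isUnit_iff_exists_inv.mpr ⟨(17 : ZMod 72), by decide⟩)).mono
    fun p hp ↦ ⟨hp.1, Or.inl hp.2⟩

end Dirichlet

/-! ## §2 ★★ The `2`-isogeny corners are infinite families, modulo Burungale–Tian ONLY -/

section Corners

/-- ★★ **Infinitely many `(E_p, p)`.** Modulo Burungale–Tian ONLY: for infinitely many primes `p` (all `p ≡ 7 (mod 8)`, Dirichlet) the conclusion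
of crux 21381 holds at `(E_p, p)`, `E_p : y² = x³ − p²x`: a Heegner field `K′` of `N(E_p)` with `4 < |d_{K′}|`, `L(E_p^{(d_{K′})}, 1) ≠ 0`,
`h(K′) < p`, `p ∤ h(K′)` (`cruxOnEpCornerAllP`, bed-w2 g13). [cite: BurungaleTian2026, Thm. 1.1] [cite: IrelandRosen1990, Ch. 16 §1] -/
theorem infinite_EpCorner (hBT : burungaleTian_analyticRank_eq_zero_of_selmerCorank_eq_zero_of_hasCM) :
    Set.Infinite {p : ℕ | ∃ hp : p.Prime,
      haveI := isElliptic_congruentNumberCurve hp.ne_zero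
      ∃ (K : Type) (_ : Field K) (_ : NumberField K),
        IsImaginaryQuadratic K ∧ 4 < (NumberField.discr K).natAbs ∧
        SatisfiesHeegnerHypothesis ((congruentNumberCurve p).conductorNorm ℤ) K ∧
        ((congruentNumberCurve p).quadraticTwist (NumberField.discr K : ℚ)).entireLFunction 1 ≠ 0 ∧
        NumberField.classNumber K < p ∧ ¬ p ∣ NumberField.classNumber K} := by
  refine infinite_setOf_prime_mod_eight.mono fun p hp ↦ ?_
  obtain ⟨hp, hp8⟩ := hp
  haveI : Fact p.Prime := ⟨hp⟩
  exact ⟨hp, cruxOnEpCornerAllP hBT p hp8⟩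

/-- ★★ **Infinitely many `(X_{p^k}, p)`, `k ∈ {1, 3}`.** Modulo Burungale–Tian ONLY: for infinitely many primes `p` (all `p ≡ 15 (mod 16)`,
Dirichlet) the conclusion of crux 21381 holds at `(X_{p^k}, p)`, `X_{p^k} : y² = x³ + p^k x` (`cruxOnQuarticCornerAllP`, bed-w4 g14).
[cite: BurungaleTian2026, Thm. 1.1] [cite: IrelandRosen1990, Ch. 16 §1] -/
theorem infinite_quarticCorner (hBT : burungaleTian_analyticRank_eq_zero_of_selmerCorank_eq_zero_of_hasCM) {k : ℕ} (hk : k = 1 ∨ k = 3) :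
    Set.Infinite {p : ℕ | ∃ _ : Fact p.Prime,
      haveI := isElliptic_Xpow p k
      ∃ (K : Type) (_ : Field K) (_ : NumberField K),
        IsImaginaryQuadratic K ∧ 4 < (NumberField.discr K).natAbs ∧
        SatisfiesHeegnerHypothesis ((⟨0, 0, 0, (p : ℚ) ^ k, 0⟩ : WeierstrassCurve ℚ).conductorNorm ℤ) K ∧
        ((⟨0, 0, 0, (p : ℚ) ^ k, 0⟩ : WeierstrassCurve ℚ).quadraticTwist (NumberField.discr K : ℚ)).entireLFunction 1 ≠ 0 ∧
        NumberField.classNumber K < p ∧ ¬ p ∣ NumberField.classNumber K} := by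
  refine infinite_setOf_prime_mod_sixteen.mono fun p hp ↦ ?_
  obtain ⟨hp, hp16⟩ := hp
  haveI : Fact p.Prime := ⟨hp⟩
  exact ⟨inferInstance, cruxOnQuarticCornerAllP hBT p k hp16 hk⟩

/-- **Both corners at once**: infinitely many primes `p` (all `p ≡ 15 (mod 16)`) carry THREE curves of the habitat — `E_p`, `X_p`, `X_{p³}` — at
which the conclusion of crux 21381 holds, modulo Burungale–Tian ONLY. [cite: BurungaleTian2026, Thm. 1.1] [cite: IrelandRosen1990, Ch. 16 §1] -/
theorem infinite_threeCurves (hBT : burungaleTian_analyticRank_eq_zero_of_selmerCorank_eq_zero_of_hasCM) :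
    Set.Infinite {p : ℕ | ∃ _ : Fact p.Prime,
      (haveI := isElliptic_congruentNumberCurve (Fact.out : p.Prime).ne_zero
       ∃ (K : Type) (_ : Field K) (_ : NumberField K),
        IsImaginaryQuadratic K ∧ 4 < (NumberField.discr K).natAbs ∧
        SatisfiesHeegnerHypothesis ((congruentNumberCurve p).conductorNorm ℤ) K ∧
        ((congruentNumberCurve p).quadraticTwist (NumberField.discr K : ℚ)).entireLFunction 1 ≠ 0 ∧
        NumberField.classNumber K < p ∧ ¬ p ∣ NumberField.classNumber K) ∧
      (∀ k : ℕ, k = 1 ∨ k = 3 →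
        haveI := isElliptic_Xpow p k
        ∃ (K : Type) (_ : Field K) (_ : NumberField K),
          IsImaginaryQuadratic K ∧ 4 < (NumberField.discr K).natAbs ∧
          SatisfiesHeegnerHypothesis ((⟨0, 0, 0, (p : ℚ) ^ k, 0⟩ : WeierstrassCurve ℚ).conductorNorm ℤ) K ∧
          ((⟨0, 0, 0, (p : ℚ) ^ k, 0⟩ : WeierstrassCurve ℚ).quadraticTwist (NumberField.discr K : ℚ)).entireLFunction 1 ≠ 0 ∧
          NumberField.classNumber K < p ∧ ¬ p ∣ NumberField.classNumber K)} := by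
  refine infinite_setOf_prime_mod_sixteen.mono fun p hp ↦ ?_
  obtain ⟨hp, hp16⟩ := hp
  haveI : Fact p.Prime := ⟨hp⟩
  exact ⟨inferInstance, cruxOnEpCornerAllP hBT p (by omega), fun k hk ↦ cruxOnQuarticCornerAllP hBT p k hp16 hk⟩

end Corners

end Summit.BirchSwinnertonDyer.BirchSwinnertonDyer.Theorems.CornersInfinite
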